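import Summits.CriticalPhenomena.PercolationContinuityZ3.Theorems.Transplant.SkelPhiFaceRunNbT
import Summits.CriticalPhenomena.PercolationContinuityZ3.Theorems.Transplant.SkelPhiFaceRunNb
import Summits.CriticalPhenomena.PercolationContinuityZ3.Theorems.Transplant.SkelPhiFaceRunNb2
import Literature.Probability.Percolation.OrientedHistorySiteRenormalizationRun
import Summits.CriticalPhenomena.PercolationContinuityZ3.Theorems.Transplant.SkelPhiCellsSmallMT
import Summits.CriticalPhenomena.PercolationContinuityZ3.Theorems.Transplant.SkelPhiCellsWeakGLevelsT
import Summits.CriticalPhenomena.PercolationContinuityZ3.Theorems.Transplant.SkelPhiFaceDataNT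
import Summits.CriticalPhenomena.PercolationContinuityZ3.Theorems.Transplant.SkelPhiFaceDataNbHistT
import Summits.CriticalPhenomena.PercolationContinuityZ3.Theorems.Transplant.SkelPhiFaceDataNbT
import Summits.CriticalPhenomena.PercolationContinuityZ3.Theorems.Transplant.SkelPhiFaceOblNbT
import Summits.CriticalPhenomena.PercolationContinuityZ3.Theorems.Transplant.KNCells2KitAtRunO
import Summits.CriticalPhenomena.PercolationContinuityZ3.Theorems.Transplant.KNCells2SchemeO
import Summits.CriticalPhenomena.PercolationContinuityZ3.Theorems.Transplant.KNCellsSchemeO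
import Summits.CriticalPhenomena.PercolationContinuityZ3.Theorems.Transplant.PlanarCells2TDefs
import Summits.CriticalPhenomena.PercolationContinuityZ3.Theorems.Transplant.SkelKitResiduesOF
import HarnessLib
/-!
(R-40) SUCCESSOR `…T` (hp-8 g42, 2026-08-23; ruling p3-g16 06:23:56Z, J18): the twin of `SkelPhiFaceRunNb2S` over the PER-AXIS creep cap `PCells2T` (PlanarCells2TDefs:
`c i ≤ r (oth i)` instead of the uniform `c i ≤ cmax ≤ r j`); statements and proofs VERBATIM with `PCells2S ↦ PCells2T` (+ the renames of record of the T layer below it);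
the only mathematical touch points are the places that read the cap, which only ever need the cross form `c (oth j) ≤ r j` (listed in the lane line of this file's landing).
NO landed file is edited; `SkelPhiFaceRunNb2S` stays valid (and is an instance of this file through `PCells2S.toT`). NON-VACUITY: inherited verbatim from `SkelPhiFaceRunNb2S` (same witness line).

# N2 (frames-only node `SamePDropOfSkeletonFrm₁`, OPEN) — WAVE 1, (F) face-data column over STAGGERED cells ((R-22) `PCells2T`, (R-28)(β) one landing per file): the twin of N1's `SkelPhiFaceRunNb2`

builds on p205010 (kernel theorem, internal audit signed; external expert review pending) — nothing in this file uses p205010; NOTHING is claimed about the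
open node `SamePDropOfSkeletonFrm₁` (`SamePDropOfSkeletonNeg₁` is CLOSED in the tree and untouched by this file).
Status sentence (coordinator 2026-08-20T04:30Z): "θ(p_c) = 0 on ℤ^d, all d ≥ 2 — kernel-verified (Lean 4/Mathlib, standard axioms); internal adversarial
audit SIGNED 2026-08-20 04:29Z; external expert review pending."
Lane `prim-bschramm`, seat `prim-hp-8` (gen 40); helper file (`--supports stmt-CriticalPhenomena-4575 --as helper`); design owner p3-g15 ((R-22) staggered
cells `PCells2T`, (R-27)/(R-29) far regions of record `FarNS/FarNS₂`, (R-28)(β), naming 2026-08-22T23:00:04Z: suffix `S`).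
PORT RULES (HOME/prim-hp-8/code/gen40/orient/bin/port_s.py = stmt-g19's port_orient.py + the G token table): the cells are `P : PCells2T`, every box is
read about the STAGGERED centre `cenS` (`PlanarCells2SDefs/SFar/ContainS/SArm/SepS/SepInfS/LevelsS/EfarN2S`), the scheme record is `cellGeomSG₂T`/`cellGeomSG₂bT`
(`SkelPhiCellsWeakGS/…SmallMS`: narrow arm `BtwNS`, two-block far region `FarNS₂`), the history-site API is the ORIENTED one at `qNE` where it occurs
(`ochoice qNE`, `onwardO`, `Valid₂O`, `IsRun₂O`, …, (R-18)); EVERY declaration is re-declared with the suffix `S` (same namespace). Docstrings/citations are N1's.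
N1 HEADER (kept for the reader):
* **`faceOblRM_fineNb2`**.
[cite: KozmaNitzan2024, §4 Lemma 12 (pp. 23–25), p. 30 (Step III)] [cite: Timar2007, Lemma 2.2, p. 3]
-/
noncomputable section

open MeasureTheory
open scoped Classical

namespace Summit.CriticalPhenomena.PercolationContinuityZ3.Theorems.Transplant

namespace Skelφ

open Literature.Probability.Percolation Literature.Probability.LatticeModels SimpleGraph KNCells KNLevels GadgetSystem Contour
open Literature.Probability.Percolation.KozmaNitzan
open Literature.Probability.Percolation.KozmaNitzan.Cells (oth oth_ne sgOf sgOf_sign stepVec_apply_fst stepVec_apply_oth eq_oth_of_ne oth_oth)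
open Literature.Barriers.CriticalPhenomena (graphBall graphBall_finite mem_graphBall_self graphBall_mono)
open BoxProdZ2 (ConcRadiiG Erad Frad nQ nS Realised Frad_succ Frad_le_Erad)
open Skel (winGraph WinStepData excess)
open TwoAxis.Para (detD modulus rep₂)

variable {V : Type} [DecidableEq V] {G : SimpleGraph V} [G.LocallyFinite] {φ : V → Site 2}

/-! ## §1 The realised-anchor facts at the twin scheme -/

section Run

variable [Countable V] (pr : FinePrm) (φ) (P : PCells2T) (w₀ : V) (gap gap' : ℕ → ℕ) (E₀ L' : ℕ) (off : Site 2 → ℕ) (b₀ : Fin 2 → ℕ) (q : unitInterval)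
  (δc : ℝ)

/-- **`FaceOblRMO` for the fine-cell scheme of record at the N1 schedule, modulo the kit clauses along runs** (from `Lip`, `Steps` of the skeleton
map).  Along RUN histories the anchors of the chosen edge are realised, so with `g := nQ (aOf₁O) x`: `rM_{a'}(x+du) = E g + gap (E g) − L'`,
`ρ ≤ E g − 2`, `rQ_{aOf₁O}(x) = E g`; entrance depth `E g + 1`, excess radius `R₁ (E g)`; the target `M_{a'}(x+du)` holds the vertex over `cen (x+du)`
(`‖rep₂(cen(x+du))‖₁ + 1 ≤ off (x+du) ≤ c(‖x‖₁+1) + 1 ≤ rM`); per face the window map is the frame `pr.frame φ w₀ du.1 (pr.bOf du.1)` about a reference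
vertex over `faceCen`. [cite: KozmaNitzan2024, §4 p. 30 (Step III), Lemma 10 (p. 17), Lemma 12 (p. 24)] [cite: MartineauSevero2019, Cor. 2.2] -/
theorem faceOblRM_fineNb2T (hlip : Lip G φ) (hstep : Steps G φ) (hb₀ : ∀ i, b₀ i ≤ 3 * P.r i) (hb1 : ∀ i, 1 ≤ b₀ i) (hc₀ : 0 < pr.c₀)
    (hc₁ : 0 < pr.c₁)
    (hDd : pr.D = detD pr.A pr.n pr.h pr.vα pr.vβ) (hD : 0 < pr.D) (hL0 : pr.c₀ * pr.L 0 + 2 ≤ pr.D) (hL1 : pr.c₁ * pr.L 1 + 2 ≤ pr.D)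
    (hgap : ∀ n, 1 ≤ gap n) (hgap20 : ∀ n, 20 * P.rmax ≤ gap n) {c : ℕ} (hgapc : ∀ n, c ≤ gap n) (hE₀ : 2 ≤ E₀) (hL' : 1 ≤ L')
    (hoff : ∀ x : Site 2, off x ≤ c * ((x 0).natAbs + (x 1).natAbs) + 1)
    (hoffN : ∀ x : Site 2, (rep₂ pr.A pr.n pr.h pr.vα pr.vβ pr.c₀ pr.c₁ (P.cenS x) 0).natAbs +
      (rep₂ pr.A pr.n pr.h pr.vα pr.vβ pr.c₀ pr.c₁ (P.cenS x) 1).natAbs + 1 ≤ off x)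
    {Δ' Rlev N M : ℕ} {δ₂ : ℝ} (hRlev : ∀ i, Rlev + 4 ≤ 10 * P.s i) (hRlev' : ∀ du : MDir, (Rlev : ℤ) + 5 + P.c du.1 ≤ 3 * P.r (oth du.1))
    {aw : MDir → ℕ} {k₀ : ℤ} {kF : Fin 2 → ℤ} (hk₀ : ∀ I, pr.rdN I (pr.bOf I) ≤ pr.rdK I (pr.bOf I) * k₀)
    (hk₀' : ∀ i, 3 * (P.r i : ℤ) + k₀ + 3 ≤ 5 * P.r i)
    (hroomF : ∀ du : MDir,
      pr.Mabs * (aw du + Rlev + 1) + pr.rdN du.1 (pr.bOf du.1) * (Rlev + 2) * pr.D ≤ pr.rdK du.1 (pr.bOf du.1) * kF du.1 * pr.D)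
    (hkF : ∀ I, kF I + 3 + P.c I ≤ 5 * (P.r (oth I) : ℤ))
    (haw : ∀ du : MDir, (pr.rdK 1 (pr.bOf du.1) * (P.faceExt du 0 + 1) + pr.rdK 0 (pr.bOf du.1) * (P.faceExt du 1 + 1)) * pr.D ≤
      pr.Mabs * (aw du + 1))
    (hcount : 1 / (1 - (q : ℝ)) ^ (Δ' * N) ≤ δ₂ * ((Finset.Icc (M + 1) Rlev).card : ℝ))
    {η : ℝ} (hη : η ≤ δc / 2) (R₁ : ℕ → ℕ) {m : ℕ}
    (hR₁ : ∀ ρ R', R₁ ρ ≤ R' → ∀ (Rw : ℕ) (D' A' : Finset V), (∀ d ∈ D', d ∈ graphBall G w₀ Rw) →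
      (∀ d ∈ D', ∀ d' ∈ D', φ d - φ d' ∈ box 2 m) → A' ⊆ D' → (∀ a ∈ A', a ∈ graphBall G w₀ (ρ + 1)) →
        (bondPercolation G q).real (excess G w₀ R' D' A') ≤ η)
    (hdiam : ∀ b' : Fin 2, (pr.rdK 1 b' + pr.rdK 0 b') * ((50 * P.rmax : ℕ) + 1) * pr.D ≤ pr.Mabs * (m + 1))
    (hgapR : ∀ ρ, c + 2 * L' + R₁ ρ + 2 ≤ gap ρ)
    (hkits : ∀ (h : ProbeHistory V) (e : Site 2 × MDir),
      let Λ := concRadii2N P.toPCells2 gap gap' E₀ L' off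
      let S : KSchA V ℕ := ⟨cellGeomSG₂bT G (pr.ψ φ w₀) P w₀ Λ b₀, q, δc⟩
      S.IsRun₂O G h → (S.astOf₂O G h).st.ochoice KSchA.qNE = some e → S.Valid₂O G h e →
      ∀ du ∈ S.onwardO G h (tgt e), ∀ j < P.K, ∀ o : Finset (Sym2 V), ∀ (yF : V) (pc : ℤ),
      pr.ψ φ w₀ yF = P.faceCen (tgt e) du j → pc = relφ φ w₀ yF (pr.bOf du.1) →
      let a := S.aOf₁O G h e
      let a' := S.aOf₂O G h e
      let Q := faceStepWNbT G pr φ P w₀ Λ b₀ (pr.bOf du.1) a' (tgt e) du j pc (aw du) Rlev N M L' (S.Sx G h e a a' du)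
      ∀ j' ∈ Finset.Icc Q.j₀ Q.j₁, ∃ (σ : KNLevels.SData V) (Sz : Finset V),
                                     KNLevels.SHyp (winLData G (pr.frame φ w₀ du.1 (pr.bOf du.1)) Q.root Q.Rπ Q.lo Q.hi Q.root Q.Sfin) j' σ ∧ σ.N ≤ Q.N ∧
                                     (1 - (S.p : ℝ) ^ σ.sB) ^ σ.k ≤ δ₂ ∧ Sz ⊆ stepRg G (pr.frame φ w₀ du.1 (pr.bOf du.1)) Q ∧ (∀ x ∈ σ.K, σ.face x ⊆ Sz) ∧
                                     KNLevels.RelayClause (winLData G (pr.frame φ w₀ du.1 (pr.bOf du.1)) Q.root Q.Rπ Q.lo Q.hi Q.root Q.Sfin) (S.Wt G h e a a' du j o) j' σ Sz Q.T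
                                       (stepRg G (pr.frame φ w₀ du.1 (pr.bOf du.1)) Q) δ₂) :
    FaceOblRMOF G (⟨cellGeomSG₂bT G (pr.ψ φ w₀) P w₀ (concRadii2N P.toPCells2 gap gap' E₀ L' off) b₀, q, δc⟩ : KSchA V ℕ)
      (faceDataSGT G (pr.ψ φ w₀) P w₀ (concRadii2N P.toPCells2 gap gap' E₀ L' off)) Δ' δ₂ := by
  intro h e hrun hch hV du hdu j hj o
  set Λ := concRadii2N P.toPCells2 gap gap' E₀ L' off with hΛdef
  set S : KSchA V ℕ := ⟨cellGeomSG₂bT G (pr.ψ φ w₀) P w₀ Λ b₀, q, δc⟩ with hS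
  -- the two maps
  have hL0' : pr.c₀ * pr.L 0 ≤ pr.D := by omega
  have hL1' : pr.c₁ * pr.L 1 ≤ pr.D := by omega
  have hlipψ : Lip G (pr.ψ φ w₀) := pr.lip_ψ hlip w₀ hc₀.le hc₁.le hD hL0' hL1'
  have hws : WeakSteps G (pr.ψ φ w₀) := pr.weakSteps_ψ hstep w₀ hc₀.le hc₁.le hD
  have hψ0 : pr.ψ φ w₀ w₀ = 0 := pr.ψ_base φ w₀ hD
  have hcI : 0 < pr.cOf du.1 := pr.cOf_pos hc₀ hc₁ du.1
  have hLI : pr.cOf du.1 * pr.L du.1 ≤ pr.D := pr.cOf_mul_L_le hL0' hL1' du.1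
  have hM := pr.A_mul_modulus_ne_zero hDd hD
  have hnz : pr.lvGen du.1 (pr.bOf du.1) ≠ 0 := pr.lvGen_bOf_ne_zero du.1 (pr.lvGen_ne_zero_of_detD_pos hDd hD du.1)
  have hlipF : Lip G (pr.frame φ w₀ du.1 (pr.bOf du.1)) := pr.lip_frame hlip w₀ du.1 (pr.bOf du.1) hcI.le hD hLI
  -- the schedule and the realised radii
  have hΛ : WFS2 P.toPCells2 Λ := concRadii2N_WFS2 P.toPCells2 gap gap' E₀ L' off hgap hE₀ hL'
  have hr : Realised (S.aOf₁O G h e) (S.aOf₂O G h e) (tgt e) := realised_of_choice_SG₂bT h hch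
  have hy : tgt e + stepVec du ≠ 0 := tgt_add_stepVec_ne_zero₂bT hψ0 hV hdu
  have hE₀' : 1 ≤ E₀ := by omega
  have hxn : (tgt e 0).natAbs + (tgt e 1).natAbs ≤ nQ (S.aOf₁O G h e) (tgt e) := l1_tgt_le_nQ₂bT h hch
  set g := nQ (S.aOf₁O G h e) (tgt e) with hg
  have hrM : Λ.rM (S.aOf₂O G h e) (tgt e + stepVec du) = Erad gap gap' E₀ g + gap (Erad gap gap' E₀ g) - L' := by
    change Frad gap gap' E₀ (nQ (S.aOf₂O G h e) (tgt e + stepVec du)) - L' = _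
    rw [hr.nQ_add_stepVec hy, Frad_succ]
  have hρ : ∀ ℓ, Λ.ρ (S.aOf₂O G h e) (tgt e) du ℓ ≤ Erad gap gap' E₀ g := fun ℓ =>
    (concRadii2N_ρ_le P.toPCells2 gap gap' E₀ L' off _ _ _ ℓ).trans (by rw [hr.nS_eq]; exact Nat.sub_le _ _)
  have hQ : Λ.rQ (S.aOf₁O G h e) (tgt e) ≤ Erad gap gap' E₀ g :=
    (concRadii2N_rQ_eq_of_norm_le P.toPCells2 gap' E₀ L' off hgap20 hgapc hE₀' hxn (hoff _)).le
  have hgapg := hgapR (Erad gap gap' E₀ g)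
  have hElin := Erad_linear gap' E₀ hgapc g
  -- the true target holds the vertex over `cen (x + du)`
  have hMne : (S.Γ.M (S.aOf₂O G h e) (tgt e + stepVec du)).Nonempty := by
    obtain ⟨y, hyb, hyc⟩ := pr.exists_vertex_ψ_eq hstep w₀ hc₀ hc₁ hDd hD hL0 hL1 (P.cenS (tgt e + stepVec du)) le_rfl
    refine M_nonempty_of_vertex_bT b₀ hlipψ hws hb1 hyb hyc ?_
    have h1 := hoffN (tgt e + stepVec du)
    have h2 := hoff (tgt e + stepVec du)
    have h3 := norm_add_stepVec_le (tgt e) du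
    have h4 : c * (((tgt e + stepVec du) 0).natAbs + ((tgt e + stepVec du) 1).natAbs) ≤ c * (g + 1) := Nat.mul_le_mul_left _ (by omega)
    change _ ≤ Λ.rM (S.aOf₂O G h e) (tgt e + stepVec du)
    rw [hrM]
    have : c * (g + 1) = c * g + c := by ring
    omega
  -- the reference vertex over the face centre
  obtain ⟨yF, -, hyF⟩ := pr.exists_vertex_ψ_eq hstep w₀ hc₀ hc₁ hDd hD hL0 hL1 (P.faceCen (tgt e) du j) le_rfl
  have hRlev₁ : Rlev + 4 ≤ 10 * P.s du.1 := hRlev du.1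
  have hRlev₂ : (Rlev : ℤ) + 5 + P.c du.1 ≤ 3 * P.r (oth du.1) := hRlev' du
  refine faceOblAtM_fineNbT hΛ hb₀ hV hdu hlipψ hws hlipF hc₀ hc₁ hD hM hnz (show j + 1 ≤ P.K from hj) hyF rfl hRlev₁ hRlev₂
    (hk₀ du.1) (hk₀' (oth du.1)) (hroomF du) (hkF du.1) (haw du) hcount hMne
    (fun j' hj' => hkits h e hrun hch hV du hdu j hj o yF _ hyF rfl j' hj') hQ hρ hη (hR₁ (Erad gap gap' E₀ g)) ?_
    (hdiam_fine_bT (a' := S.aOf₂O G h e) hM hc₀ hc₁ hD hdiam (tgt e) du)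
  rw [hrM]; omega

end Run

end Skelφ

end Summit.CriticalPhenomena.PercolationContinuityZ3.Theorems.Transplant

end
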